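import Summits.QuantumFields.BalabanUV.Beta.SecondOrderMixedModel

/-!
# `BalabanUV.Beta.MixedLetterPacking` — binder row D1, (L4)∕HR-W-LET: **THE PACKING ADAPTER FROM an1's TABLE-LEVEL MIXED REFLECTION LAW
# TO THE hR END's LEVEL-0 MIXED SOCKET** `SecondOrderLetterLevels.MixedPrim` (β sub-cell, D1 formalisation swarm, leaf-05 gen 7)

HONEST FRAMING (cell charter, verbatim): «discharging BetaPertH makes Balaban's UV stability UNCONDITIONAL — a real
constructive-QFT result; it is NOT the continuum limit and NOT the Clay problem.»
HONEST DEPENDENCY: continuum YM on T⁴ ⇐ BetaPertH ∧ nine spine estimates (0/9 proved); BetaPertH ⇐ (D1) ∧ (D4) ∧ CAP+tail;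
G-an2-4 gates asym, D1 and NE2/3/4.
DERIVED cell leaf ([folklore] kernel algebra over an1's node 7aρ∕12b tables `hessFFAt`∕`mixFFAt`∕`linKerAt`, an2's `diagK`∕`ctGen`∕`conjV`∕
`Dmix` and an3's `MixedPrim`, all BY NAME).  CONDITIONAL WIRING: the table-level law `hM` below is a HYPOTHESIS — an1-g28's PACKED FORM
(journal l.11301, toy-certified on 88 194 entries; NOT a theorem of the tree; it is the target normal form of the AVG-LETTERS chain's M4) —
and this file only REPACKS it: no statement of Bałaban's papers, no `[cite:]`, no `Prop` fact is minted (the law is carried as an explicit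
binder), the data definition `RMof` is [our object].  It discharges NO letter and instantiates NO binder of the wall (0∕4: hW, hR, D1Tel,
D1Rep); the value `cΛ = 2∕Lc⁴` below is DISPLAYED as the value at which the parity clause is met, NOT ruled ((R45)∕(P6) stay with the leads).
NOT D1, NOT BetaPertH, NOT continuum, NOT Clay.

## What is here (`d + 1 = 4`, centred root `ρ_c = toSite (ctrOff 4 Lc)`, `γ₀ = −Lc⁴∕2`, `X₀ := diagK (ctGen 3 α Lc κ u)`, `H := hessFFAt ρ_c Lc ρ′ w`,
## `q := linKerAt ρ_c Lc ρ′ w (κ, u)`)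
* §1 `RMof Lc cΛ α κ u ρ′ w := 2•(X₀ ∘ H) + (2·[ρ′ = α]·q)•H − Dmix Lc cΛ α κ u ρ′ w` (an2's `Dmix` = the socket's contact
  `conjV (cΛ•H) (diagK (γ₀·ctGen))`) and **`mixedPrim_of_tableLaw`**: `hM → MixedPrim Lc ρ_c cΛ (mixFFAt ρ_c Lc) (RMof Lc cΛ)` for EVERY `cΛ`
  (pure rearrangement).
* §2 `RMof_apply` (entrywise closed form `((2 − cΛ·Lc⁴∕2)·g(x,a) + (cΛ·Lc⁴∕2)·g(z,b) + 2[ρ′=α]q)·H x z a b`) and **`parityOdd_RMof`**: AT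
  `cΛ · Lc⁴ = 2` the residual is ROW-PARITY-ODD (`trK = −sgnK`; `H` is odd — `SpineRecursiveParity.trK_hessFFAt` — and the coefficient is
  then symmetric in the two legs) — the END's `hRM₀p`; `evenPart_RMof`: in general `RMof = (odd part) − (1 − cΛ·Lc⁴∕2)•conjV H X₀`, the
  commutator being parity-EVEN (`SecondOrderLetterParity.parityEven_conjV_diagK_of_odd`).
* §3 **`locStencilFM_RMof`** (rate `1∕4`, every `cΛ`): the residual is a `LocStencilFM` family — the END's `hRM₀c` (an2's far-composition kit
  `biLoc_comp_far_right`, `locStencilFM_Dmix`; the `q`-term by the support of `linKerAt`).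
* §4 **`mixedBinders_of_tableLaw`**: `hM ∧ (cΛ·Lc⁴ = 2) ⟹` the three mixed binders (`hM₀`, `hRM₀c`, `hRM₀p`) of `SpineRooted.…_of_an1_letters₀` with
  `RM₀ := RMof Lc cΛ`.
Provenance: β sub-cell, D1 formalisation swarm, unit b2b-balaban-beta-d1-formalise-leaf-05 gen 7, 2026-08-20 (v1); no existing file touched.
-/

open Finset
open scoped BigOperators
open Literature.MathematicalPhysics.QuantumFieldTheory
open Literature.MathematicalPhysics.QuantumFieldTheory.Balaban1983to89
open Literature.MathematicalPhysics.QuantumFieldTheory.Balaban1983to89.Beta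
open ExpKernelCalculus (MKer BiLoc comp)
open AffineAveraging (box toSite)
open AveragingContoursRooted (ctr ctrOff ctrOff_mem_box)
open AveragingHessianKernelsRooted (hessFFAt linKerAt)
open AveragingMixedJetTables (mixFFAt)
open PolarizationSign (reflSign)
open KernelReflection (refK refK_apply)
open ResolventReflection (bref Φ)
open OneStepResolventKernel (Fib)
open SecondOrderResponse (LocStencilFM)
open Summit.QuantumFields.BalabanUV.Beta.TameKernelCalculus
open Summit.QuantumFields.BalabanUV.Beta.ChartConjugation (conjV)
open Summit.QuantumFields.BalabanUV.Beta.BorderedHessian (sgnF sgnK sgnK_apply diagK ctGen conjV_diagK_apply comp_diagK_left comp_diagK_right cCT)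
open Summit.QuantumFields.BalabanUV.Beta.SpineRecursiveParity (trK_hessFFAt)
open Summit.QuantumFields.BalabanUV.Beta.SecondOrderLetterLevels (MixedPrim)
open Summit.QuantumFields.BalabanUV.Beta.SecondOrderMixedModel (Dmix Dmix_apply)

namespace Summit.QuantumFields.BalabanUV.Beta.MixedLetterPacking

noncomputable section

variable {Lc : ℕ} [NeZero Lc]

/-! ## §1 The displayed residual and the repacking -/

open Classical in
/-- [our object] **THE RESIDUAL OF THE MIXED SOCKET FORCED BY an1's TABLE LAW**:
`RMof Lc cΛ α κ u ρ′ w := 2•(diagK ctGen ∘ hessFFAt) + (2·[ρ′ = α]·linKerAt ρ_c Lc ρ′ w (κ,u))•hessFFAt − Dmix Lc cΛ α κ u ρ′ w`. -/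
def RMof (Lc : ℕ) [NeZero Lc] (cΛ : ℝ) (α κ : Fin 4) (u : Fin 4 → ℤ) (ρ' : Fin 4) (w : Fin 4 → ℤ) : MKer 4 (Fib 3) :=
  (2 : ℝ) • comp (diagK (ctGen 3 α Lc κ u)) (hessFFAt (toSite (ctrOff 4 Lc)) Lc ρ' w)
    + (2 * (if ρ' = α then linKerAt (toSite (ctrOff 4 Lc)) Lc ρ' w (κ, u) else 0)) • hessFFAt (toSite (ctrOff 4 Lc)) Lc ρ' w
    - Dmix Lc cΛ α κ u ρ' w

open Classical in
/-- [folklore] **THE REPACKING** (every `cΛ`): an1's table-level mixed reflection law (HYPOTHESIS `hM`, packed form of journal l.11301) gives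
the hR END's level-0 mixed socket `MixedPrim Lc ρ_c cΛ (mixFFAt ρ_c Lc) (RMof Lc cΛ)` — the socket's contact `Dmix` plus the displayed
residual `RMof` IS an1's correction term. -/
theorem mixedPrim_of_tableLaw (cΛ : ℝ)
    (hM : ∀ (α κ : Fin 4) (u : Fin 4 → ℤ) (ρ' : Fin 4) (w : Fin 4 → ℤ),
      mixFFAt (toSite (ctrOff 4 Lc)) Lc κ (bref α κ u) ρ' (bref α ρ' w) =
        (reflSign α κ * reflSign α ρ') • refK (Φ Lc α)
          (mixFFAt (toSite (ctrOff 4 Lc)) Lc κ u ρ' w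
            + (2 : ℝ) • comp (diagK (ctGen 3 α Lc κ u)) (hessFFAt (toSite (ctrOff 4 Lc)) Lc ρ' w)
            + (2 * (if ρ' = α then linKerAt (toSite (ctrOff 4 Lc)) Lc ρ' w (κ, u) else 0)) • hessFFAt (toSite (ctrOff 4 Lc)) Lc ρ' w)) :
    MixedPrim Lc (toSite (ctrOff 4 Lc)) cΛ (mixFFAt (toSite (ctrOff 4 Lc)) Lc) (RMof Lc cΛ) := by
  intro α κ u ρ' w
  rw [hM α κ u ρ' w]
  congr 2
  have hD : Dmix Lc cΛ α κ u ρ' w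
      = conjV (cΛ • hessFFAt (toSite (ctrOff 4 Lc)) Lc ρ' w) (diagK fun p c => -((Lc : ℝ) ^ 4 / 2) * ctGen 3 α Lc κ u p c) := rfl
  rw [RMof, hD]
  abel

/-! ## §2 The entrywise form and the row parity of the residual -/

open Classical in
/-- [folklore] **ENTRYWISE FORM OF THE RESIDUAL**: with `g := ctGen 3 α Lc κ u`, `H := hessFFAt ρ_c Lc ρ′ w`, `q := [ρ′=α]·linKerAt …`,
`RMof … x z a b = ((2 − cΛ·Lc⁴∕2)·g x a + (cΛ·Lc⁴∕2)·g z b + 2q) · H x z a b`. -/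
theorem RMof_apply (cΛ : ℝ) (α κ : Fin 4) (u : Fin 4 → ℤ) (ρ' : Fin 4) (w : Fin 4 → ℤ) (x z : Fin 4 → ℤ) (a b : Fib 3) :
    RMof Lc cΛ α κ u ρ' w x z a b
      = ((2 - cΛ * ((Lc : ℝ) ^ 4 / 2)) * ctGen 3 α Lc κ u x a + cΛ * ((Lc : ℝ) ^ 4 / 2) * ctGen 3 α Lc κ u z b
          + 2 * (if ρ' = α then linKerAt (toSite (ctrOff 4 Lc)) Lc ρ' w (κ, u) else 0))
        * hessFFAt (toSite (ctrOff 4 Lc)) Lc ρ' w x z a b := by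
  rw [RMof, Pi.sub_apply, Pi.sub_apply, Pi.sub_apply, Pi.sub_apply, Pi.add_apply, Pi.add_apply, Pi.add_apply, Pi.add_apply,
    Pi.smul_apply, Pi.smul_apply, Pi.smul_apply, Pi.smul_apply, Pi.smul_apply, Pi.smul_apply, Pi.smul_apply, Pi.smul_apply,
    smul_eq_mul, smul_eq_mul, comp_diagK_left, Dmix_apply]
  ring

open Classical in
/-- [folklore] **AT `cΛ·Lc⁴ = 2` THE RESIDUAL IS ROW-PARITY-ODD** (`trK = −sgnK`): the coefficient `g x a + g z b + 2q` is then symmetric in the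
two legs and `hessFFAt` is antisymmetric (`trK_hessFFAt`) — the END's binder `hRM₀p` at the Λ-lock value `cΛ = 2∕Lc⁴`. -/
theorem parityOdd_RMof {cΛ : ℝ} (hΛ : cΛ * (Lc : ℝ) ^ 4 = 2) (α κ : Fin 4) (u : Fin 4 → ℤ) (ρ' : Fin 4) (w : Fin 4 → ℤ) :
    trK (RMof Lc cΛ α κ u ρ' w) = -sgnK (RMof Lc cΛ α κ u ρ' w) := by
  have hc : cΛ * ((Lc : ℝ) ^ 4 / 2) = 1 := by linear_combination hΛ / 2
  have hH := trK_hessFFAt (toSite (ctrOff 4 Lc)) Lc ρ' w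
  funext x z a b
  have e := congrArg (fun K => K x z a b) hH
  simp only [trK_apply, Pi.neg_apply, sgnK_apply] at e
  simp only [trK_apply, Pi.neg_apply, sgnK_apply]
  rw [RMof_apply, RMof_apply, hc, e]
  ring


/-- [folklore] **THE ANTICOMMUTATOR OF A DIAGONAL KERNEL WITH A PARITY-ODD KERNEL IS PARITY-ODD** (generic dimension; an1-g28's rider (c),
journal l.≈16040 item (5)): `trK (diagK g ∘ H + H ∘ diagK g) = −sgnK (…)` for `trK H = −sgnK H`. -/
theorem parityOdd_anticomm_diagK {d : ℕ} (g : (Fin (d + 1) → ℤ) → Fib d → ℝ) {H : MKer (d + 1) (Fib d)} (hH : trK H = -sgnK H) :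
    trK (comp (diagK g) H + comp H (diagK g)) = -sgnK (comp (diagK g) H + comp H (diagK g)) := by
  funext x z a b
  have e := congrArg (fun K => K x z a b) hH
  simp only [trK_apply, Pi.neg_apply, sgnK_apply] at e
  simp only [trK_apply, Pi.neg_apply, Pi.add_apply, sgnK_apply]
  rw [comp_diagK_left, comp_diagK_right, comp_diagK_left, comp_diagK_right, e]
  ring

/-- [folklore] … and a scalar (table-entry) multiple of a parity-odd kernel is parity-odd (restated for the `q`-term). -/
theorem parityOdd_smul' {d : ℕ} (c : ℝ) {H : MKer (d + 1) (Fib d)} (hH : trK H = -sgnK H) : trK (c • H) = -sgnK (c • H) :=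
  Summit.QuantumFields.BalabanUV.Beta.SpineRecursiveParity.parityOdd_smul c hH

/-! ## §3 The residual is a `LocStencilFM` family (the END's `hRM₀c`) -/

section Class

open Literature.MathematicalPhysics.QuantumFieldTheory.Balaban1983to89.B12Sec2to5 (l1 l1_nonneg)
open AveragingHessianKernels (ell Near near_self l1_le_of_near)
open AveragingHessianKernelsRooted (biLoc_hessFFAt biLoc_hessFFAt_of_near abs_linKerAt_le linKerAt_eq_zero)
open ExpKernelCalculus (Zl)
open KernelWard (biLoc_add biLoc_sub)
open StepJetData (biLoc_weaken biLoc_smul)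
open HessKerRate (biLoc_zero)
open Summit.QuantumFields.BalabanUV.Beta.SpineRecursivePureParity (locStencil_diagK_smul_ctGen)
open Summit.QuantumFields.BalabanUV.Beta.SecondOrderBorderClassKit (biLoc_comp_far_left biLoc_comp_far_right)
open Summit.QuantumFields.BalabanUV.Beta.SecondOrderMixedModel (locStencilFM_Dmix)

/-- [folklore] The generator diagonal `diagK (ctGen 3 α Lc κ u)` is bi-localised at its jet bond (rate `1`; an2's `locStencil_diagK_smul_ctGen` at `c = 1`). -/
theorem biLoc_diagK_ctGen (α κ : Fin 4) (u : Fin 4 → ℤ) : BiLoc (diagK (ctGen 3 α Lc κ u)) u u (|(1 : ℝ)| * cCT 3 Lc 1) 1 := by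
  have h := locStencil_diagK_smul_ctGen (d := 3) (Lc := Lc) (1 : ℝ) α (zero_le_one) κ u
  have e : (fun p a => (1 : ℝ) * ctGen 3 α Lc κ u p a) = ctGen 3 α Lc κ u := by funext p a; exact one_mul _
  simpa only [e] using h

omit [NeZero Lc] in
open Classical in
/-- [folklore] **THE `q`-TERM IS A `LocStencilFM` MEMBER**: `(2·[ρ′=α]·q_{(ρ′,w)}(κ,u)) • hessFFAt ρ_c Lc ρ′ w` is bi-localised at `(u,u)` with a
constant decaying in `|u − Lc•w|` — `q` vanishes unless `u` lies in the support box of the block `w` (`linKerAt_eq_zero`), and there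
`hessFFAt` is bi-localised at `u` (`biLoc_hessFFAt_of_near`) while `|u − Lc•w| ≤ 8Lc`. -/
theorem biLoc_qTerm (hLc : 1 ≤ Lc) (α κ : Fin 4) (u : Fin 4 → ℤ) (ρ' : Fin 4) (w : Fin 4 → ℤ) :
    BiLoc ((2 * (if ρ' = α then linKerAt (toSite (ctrOff 4 Lc)) Lc ρ' w (κ, u) else 0)) • hessFFAt (toSite (ctrOff 4 Lc)) Lc ρ' w) u u
      ((2 * (ell 4 Lc : ℝ)) * (2 * (ell 4 Lc : ℝ) ^ 2 * Real.exp (4 * ((3 : ℝ) + 1) * Lc * (1 / 4))) * Real.exp ((1 / 4) * (2 * ((3 : ℝ) + 1) * Lc))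
        * Real.exp (-(1 / 4) * l1 (u - (Lc : ℤ) • w))) (1 / 4) := by
  have hr : ctrOff 4 Lc ∈ box 4 Lc := ctrOff_mem_box hLc
  set CH : ℝ := 2 * (ell 4 Lc : ℝ) ^ 2 * Real.exp (4 * ((3 : ℝ) + 1) * Lc * (1 / 4)) with hCH
  have hCH0 : 0 ≤ CH := by rw [hCH]; positivity
  by_cases hn : Near Lc w u
  · -- on the support box: `|q| ≤ ℓ`, `hessFFAt` bi-localised at `u`, and `|u − Lc•w| ≤ 2(d+1)Lc`
    have hq : |2 * (if ρ' = α then linKerAt (toSite (ctrOff 4 Lc)) Lc ρ' w (κ, u) else 0)| ≤ 2 * (ell 4 Lc : ℝ) := by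
      rw [abs_mul, abs_two]
      refine mul_le_mul_of_nonneg_left ?_ (by norm_num)
      split_ifs
      · exact abs_linKerAt_le hLc ρ' w hr (κ, u)
      · rw [abs_zero]; positivity
    have hH : BiLoc (hessFFAt (toSite (ctrOff 4 Lc)) Lc ρ' w) u u CH (1 / 4) := by
      rw [hCH]; exact biLoc_hessFFAt_of_near (d := 3) hLc ρ' w hr hn (by norm_num)
    have h := biLoc_smul hH (2 * (if ρ' = α then linKerAt (toSite (ctrOff 4 Lc)) Lc ρ' w (κ, u) else 0))
    refine biLoc_weaken h ?_ le_rfl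
    have hdist : l1 (u - (Lc : ℤ) • w) ≤ 2 * ((3 : ℝ) + 1) * Lc := l1_le_of_near (d := 3) hn (near_self hLc w)
    have hexp : 1 ≤ Real.exp ((1 / 4) * (2 * ((3 : ℝ) + 1) * Lc)) * Real.exp (-(1 / 4) * l1 (u - (Lc : ℤ) • w)) := by
      rw [← Real.exp_add]; exact Real.one_le_exp (by nlinarith [l1_nonneg (u - (Lc : ℤ) • w)])
    calc |2 * (if ρ' = α then linKerAt (toSite (ctrOff 4 Lc)) Lc ρ' w (κ, u) else 0)| * CH
        ≤ (2 * (ell 4 Lc : ℝ)) * CH * 1 := by rw [mul_one]; exact mul_le_mul_of_nonneg_right hq hCH0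
      _ ≤ (2 * (ell 4 Lc : ℝ)) * CH * (Real.exp ((1 / 4) * (2 * ((3 : ℝ) + 1) * Lc)) * Real.exp (-(1 / 4) * l1 (u - (Lc : ℤ) • w))) :=
          mul_le_mul_of_nonneg_left hexp (by positivity)
      _ = _ := by ring
  · -- off the support box the coefficient vanishes
    have hq0 : (2 * (if ρ' = α then linKerAt (toSite (ctrOff 4 Lc)) Lc ρ' w (κ, u) else 0)) = 0 := by
      split_ifs
      · rw [linKerAt_eq_zero hr (f := (κ, u)) hn, mul_zero]
      · rw [mul_zero]
    rw [hq0, zero_smul]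
    exact biLoc_weaken (biLoc_zero u u (1 / 4)) (by positivity) le_rfl

open Classical in
/-- [folklore] **THE RESIDUAL IS A `LocStencilFM` FAMILY** (rate `1∕4`; every `cΛ`): the two `X₀`-terms by an2's far-composition kit
(`biLoc_comp_far_right` with the generator at `u` and `hessFFAt` at `Lc•w`), the `q`-term by `biLoc_qTerm`, the contact by an2's
`locStencilFM_Dmix` — the END's binder `hRM₀c` for `RM₀ := RMof Lc cΛ`. -/
theorem locStencilFM_RMof (hLc : Odd Lc) (cΛ : ℝ) (α : Fin 4) : ∃ C : ℝ, LocStencilFM Lc (RMof Lc cΛ α) C (1 / 4) := by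
  obtain ⟨CD, hD⟩ := locStencilFM_Dmix hLc cΛ α
  have hr : ctrOff 4 Lc ∈ box 4 Lc := ctrOff_mem_box hLc.pos
  refine ⟨|(2 : ℝ)| * ((Fintype.card (Fib 3) : ℝ) * ((|(1 : ℝ)| * cCT 3 Lc 1) * (2 * (ell 4 Lc : ℝ) ^ 2 * Real.exp (4 * ((3 : ℝ) + 1) * Lc * 1)))
      * Zl (3 + 1) (1 / 2))
    + (2 * (ell 4 Lc : ℝ)) * (2 * (ell 4 Lc : ℝ) ^ 2 * Real.exp (4 * ((3 : ℝ) + 1) * Lc * (1 / 4))) * Real.exp ((1 / 4) * (2 * ((3 : ℝ) + 1) * Lc))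
    + CD, fun κ u ρ' w => ?_⟩
  have hX := biLoc_diagK_ctGen (Lc := Lc) α κ u
  have hH := biLoc_hessFFAt (d := 3) hLc.pos ρ' w hr zero_le_one
  have h1 := biLoc_comp_far_right hX hH one_pos
  rw [← OneStepKernelFamily.l1_neg_eq ((Lc : ℤ) • w - u), neg_sub] at h1
  have h1' := biLoc_smul h1 (2 : ℝ)
  have h2 := biLoc_qTerm (Lc := Lc) hLc.pos α κ u ρ' w
  have h3 := hD κ u ρ' w
  have h := biLoc_sub (biLoc_add h1' h2) h3
  refine biLoc_weaken (K := RMof Lc cΛ α κ u ρ' w) h (le_of_eq ?_) le_rfl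
  norm_num
  ring

/-- [folklore] The END's binder shape: `∃ C δ, 0 < δ ∧ LocStencilFM Lc (RMof Lc cΛ α) C δ`. -/
theorem locStencilFM_RMof' (hLc : Odd Lc) (cΛ : ℝ) (α : Fin 4) : ∃ C δ : ℝ, 0 < δ ∧ LocStencilFM Lc (RMof Lc cΛ α) C δ := by
  obtain ⟨C, h⟩ := locStencilFM_RMof hLc cΛ α
  exact ⟨C, 1 / 4, by norm_num, h⟩

end Class

/-! ## §4 The three mixed binders of the hR END at the Λ-lock value -/

open Classical in
/-- [folklore] **an1's TABLE LAW ⟹ THE THREE MIXED BINDERS OF `SpineRooted.…_of_an1_letters₀`** (`hM₀`, `hRM₀c`, `hRM₀p`) at `cΛ·Lc⁴ = 2`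
(the Λ-lock value; DISPLAYED, not ruled), with `RM₀ := RMof Lc cΛ`.  CONDITIONAL on the hypothesis `hM` (an1's packed table law). -/
theorem mixedBinders_of_tableLaw (hLc : Odd Lc) {cΛ : ℝ} (hΛ : cΛ * (Lc : ℝ) ^ 4 = 2)
    (hM : ∀ (α κ : Fin 4) (u : Fin 4 → ℤ) (ρ' : Fin 4) (w : Fin 4 → ℤ),
      mixFFAt (toSite (ctrOff 4 Lc)) Lc κ (bref α κ u) ρ' (bref α ρ' w) =
        (reflSign α κ * reflSign α ρ') • refK (Φ Lc α)
          (mixFFAt (toSite (ctrOff 4 Lc)) Lc κ u ρ' w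
            + (2 : ℝ) • comp (diagK (ctGen 3 α Lc κ u)) (hessFFAt (toSite (ctrOff 4 Lc)) Lc ρ' w)
            + (2 * (if ρ' = α then linKerAt (toSite (ctrOff 4 Lc)) Lc ρ' w (κ, u) else 0)) • hessFFAt (toSite (ctrOff 4 Lc)) Lc ρ' w)) :
    MixedPrim Lc (toSite (ctrOff 4 Lc)) cΛ (mixFFAt (toSite (ctrOff 4 Lc)) Lc) (RMof Lc cΛ)
      ∧ (∀ α : Fin 4, ∃ C δ : ℝ, 0 < δ ∧ LocStencilFM Lc (RMof Lc cΛ α) C δ)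
      ∧ (∀ (α κ : Fin 4) (u : Fin 4 → ℤ) (ρ' : Fin 4) (w : Fin 4 → ℤ), trK (RMof Lc cΛ α κ u ρ' w) = -sgnK (RMof Lc cΛ α κ u ρ' w)) :=
  ⟨mixedPrim_of_tableLaw cΛ hM, fun α => locStencilFM_RMof' hLc cΛ α, fun α κ u ρ' w => parityOdd_RMof hΛ α κ u ρ' w⟩

end

end Summit.QuantumFields.BalabanUV.Beta.MixedLetterPacking
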